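import Mathlib
import HarnessLib
import Summits.KontsevichZagierPeriods.KontsevichZagierPeriods.Theses.LinRedNormalForm
import Summits.KontsevichZagierPeriods.KontsevichZagierPeriods.Theorems.LinRedNormalFormDihedralNormalFormStubDilationNLAux3

/-!
# `DihedralNormalForm`, line `torus-descent-sum-shadow`, stub `stub_dilationNL` — the fibre analysis (Aux 4)

Support file for the stub `stub_dilationNL` (the Euler / dilation Newton–Leibniz move on the open
ordered simplex `Δᵏ⁺¹ = {1 > t₀ > ⋯ > t_k > 0}`) of the crux `DihedralNormalForm`
(stmt-KontsevichZagierPeriods-3912, route `LinRedNormalForm`).  The analysis on ONE fibre of the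
straightened band: over `y ∈ Δᵏ` the fibre is `u ↦ fib m y u = (y_{<m}, u, u·y_{≥m}/H)`,
`0 < u < H = hiEdge m y`, an affine path in `ℝᵏ⁺¹` along which the dilation field is `u ∂ᵤ`.

* `fib`, its cone point `fibS`, the affine decomposition `fib = fibA + u • fibB`;
* the primitive `prim y u = u^{k+1-m}/H^{k-m} · smono (fib y u)` and the kernel
  `kern y u = (u/H)^{k-m} · smono (fib y u) · ((k+1-m) + brkt (fib y u))`;
* `hasDerivAt_prim`: `∂ᵤ prim = kern` on the open fibre (Aux 1: affine-path derivative of the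
  monomial and the Euler identity);
* `continuousOn_prim`: `prim` is continuous on the CLOSED fibre `[0, H]` — at `u = 0` because the
  total weight `(k+1-m) + Σ_{j≥m} βⱼ + Σ_{m≤i<j} αᵢⱼ` of the dilated letters is positive
  (homogeneity, Aux 1), at `u = H` because the only collapsing letter (`t_{m-1} - t_m`, resp.
  `1 - t₀` when `m = 0`) has a non-negative exponent;
* the endpoint values `prim y 0 = 0`, `prim y H = H · smono (insertNth m H y)`.

References: M. Kontsevich, D. Zagier, *Periods* (2001), §1.2 (rule (3)).
-/

noncomputable section

open MeasureTheory Set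

namespace Summit.KontsevichZagierPeriods.DihedralNormalForm.TorusDescent

open Literature.NumberTheory.Transcendental
open Literature.ModelTheory.ExponentialFields (IsSemialgebraic)
open Summit.KontsevichZagierPeriods.DihedralNormalForm.VertexSplitting

namespace Dilation

variable {k : ℕ} (m : Fin (k + 1))

/-! ### The fibre as an affine path -/

/-- `m ≤ m.succAbove j ↔ m ≤ castSucc j`. -/
theorem le_succAbove_iff (j : Fin k) : m ≤ m.succAbove j ↔ m ≤ Fin.castSucc j := by
  rw [le_iff_lt_or_eq, Fin.lt_succAbove_iff_le_castSucc, or_iff_left (Fin.succAbove_ne m j).symm]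

/-- The fibre point over `y` with slot value `u`: `dinv m (insertNth m u y)`. -/
def fib (y : Fin k → ℝ) (u : ℝ) : Fin (k + 1) → ℝ := dinv m (Fin.insertNth m u y)

/-- The cone point of the fibre: slot `1`, the coordinates from the slot on divided by the upper edge. -/
def fibS (y : Fin k → ℝ) : Fin (k + 1) → ℝ :=
  Fin.insertNth m 1 (fun j => if m ≤ Fin.castSucc j then y j / hiEdge m y else y j)

/-- The base point of the affine fibre (the undilated coordinates). -/
def fibA (y : Fin k → ℝ) : Fin (k + 1) → ℝ := fun i => if m ≤ i then 0 else fibS m y i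

/-- The direction of the affine fibre (the dilated coordinates of the cone point). -/
def fibB (y : Fin k → ℝ) : Fin (k + 1) → ℝ := fun i => if m ≤ i then fibS m y i else 0

/-- The slot coordinate of the cone point is `1`. -/
@[simp] theorem fibS_self (y : Fin k → ℝ) : fibS m y m = 1 := by
  simp [fibS]

/-- The other coordinates of the cone point. -/
theorem fibS_succAbove (y : Fin k → ℝ) (j : Fin k) :
    fibS m y (m.succAbove j) = if m ≤ Fin.castSucc j then y j / hiEdge m y else y j := by
  simp [fibS]

/-- **Coordinates of the fibre point**: the dilated coordinates are `u` times the cone point. -/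
theorem fib_apply (y : Fin k → ℝ) (u : ℝ) (i : Fin (k + 1)) :
    fib m y u i = if m ≤ i then u * fibS m y i else fibS m y i := by
  unfold fib
  rw [dinv_insertNth]
  rcases Fin.eq_self_or_eq_succAbove m i with rfl | ⟨j, rfl⟩
  · simp
  · rw [Fin.insertNth_apply_succAbove, fibS_succAbove]
    by_cases hj : m ≤ Fin.castSucc j
    · rw [if_pos ((le_succAbove_iff m j).2 hj), sc_apply_of_le m hj, if_pos hj]
      ring
    · rw [if_neg (fun h => hj ((le_succAbove_iff m j).1 h)), sc_apply_of_lt m (not_le.1 hj), if_neg hj]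

/-- The slot coordinate of the fibre point is the parameter `u`. -/
@[simp] theorem fib_self (y : Fin k → ℝ) (u : ℝ) : fib m y u m = u := by
  rw [fib_apply, if_pos le_rfl, fibS_self, mul_one]

/-- The other coordinates of the fibre point: `y` before the slot, `u · y / H` from the slot on. -/
theorem fib_succAbove (y : Fin k → ℝ) (u : ℝ) (j : Fin k) :
    fib m y u (m.succAbove j) = if m ≤ Fin.castSucc j then u * (y j / hiEdge m y) else y j := by
  rw [fib_apply, fibS_succAbove]
  by_cases hj : m ≤ Fin.castSucc j
  · rw [if_pos ((le_succAbove_iff m j).2 hj), if_pos hj, if_pos hj]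
  · rw [if_neg (fun h => hj ((le_succAbove_iff m j).1 h)), if_neg hj, if_neg hj]

/-- The fibre is an affine path. -/
theorem fib_eq_affine (y : Fin k → ℝ) (u : ℝ) : fib m y u = fibA m y + u • fibB m y := by
  ext i
  rw [fib_apply]
  simp only [fibA, fibB, Pi.add_apply, Pi.smul_apply, smul_eq_mul]
  split_ifs <;> ring

/-- `u • fibB` is the dilated part of the fibre point. -/
theorem mul_fibB (y : Fin k → ℝ) (u : ℝ) (i : Fin (k + 1)) :
    u * fibB m y i = if m ≤ i then fib m y u i else 0 := by
  rw [fib_apply]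
  unfold fibB
  split_ifs <;> ring

/-- At the upper edge the fibre point is the face point `insertNth m H y`. -/
theorem fib_hiEdge {y : Fin k → ℝ} (hh : hiEdge m y ≠ 0) :
    fib m y (hiEdge m y) = Fin.insertNth m (hiEdge m y) y := by
  unfold fib
  rw [dinv_insertNth, div_self hh, sc_one]

/-- The coordinates of the fibre point depend continuously on `u`. -/
theorem continuous_fib_apply (y : Fin k → ℝ) (i : Fin (k + 1)) : Continuous fun u => fib m y u i := by
  simp only [fib_apply]
  split_ifs <;> fun_prop

/-! ### Inequalities on the closed fibre -/

/-- On the closed fibre every coordinate is `< 1`, except the slot coordinate at `u = 1` when `m = 0`. -/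
theorem fib_lt_one {y : Fin k → ℝ} (hy : y ∈ KZ.openOrderedSimplex k) {u : ℝ}
    (hu : u ∈ Icc 0 (hiEdge m y)) (i : Fin (k + 1)) (hi : i ≠ m ∨ 0 < (m : ℕ)) :
    fib m y u i < 1 := by
  have hh := hiEdge_pos m hy
  rcases Fin.eq_self_or_eq_succAbove m i with rfl | ⟨j, rfl⟩
  · rw [fib_self]
    have hm : 0 < ((i : Fin (k + 1)) : ℕ) := hi.resolve_left fun h => h rfl
    have e : hiEdge i y = y ⟨(i : ℕ) - 1, by omega⟩ := by simp [hiEdge, hm]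
    exact hu.2.trans_lt (e ▸ hy.2.1 _)
  · rw [fib_succAbove]
    split_ifs with hj
    · calc u * (y j / hiEdge m y) = y j * (u / hiEdge m y) := by ring
        _ ≤ y j * 1 := mul_le_mul_of_nonneg_left ((div_le_one hh).2 hu.2) (hy.1 j).le
        _ < 1 := by rw [mul_one]; exact hy.2.1 j
    · exact hy.2.1 j

/-- On the closed fibre the letters `tᵢ - tⱼ` (`i < j`, `i < m`) stay positive, except
`t_{m-1} - t_m` at `u = H`. -/
theorem fib_sub_fib_pos {y : Fin k → ℝ} (hy : y ∈ KZ.openOrderedSimplex k) {u : ℝ}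
    (hu : u ∈ Icc 0 (hiEdge m y)) {i j : Fin (k + 1)} (hij : i < j) (him : i < m)
    (hex : j = m → (i : ℕ) + 1 < (m : ℕ)) : 0 < fib m y u i - fib m y u j := by
  have hh := hiEdge_pos m hy
  obtain ⟨a, rfl⟩ := Fin.exists_succAbove_eq him.ne
  have ha : Fin.castSucc a < m := (Fin.succAbove_lt_iff_castSucc_lt m a).1 him
  have hia : fib m y u (m.succAbove a) = y a := by rw [fib_succAbove, if_neg (not_le.2 ha)]
  rw [hia, sub_pos]
  rcases Fin.eq_self_or_eq_succAbove m j with rfl | ⟨b, rfl⟩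
  · rw [fib_self]
    have hlt := hex rfl
    rw [Fin.succAbove_of_castSucc_lt _ _ ha, Fin.val_castSucc] at hlt
    have hm : 0 < (j : ℕ) := by omega
    have e : hiEdge j y = y ⟨(j : ℕ) - 1, by omega⟩ := by simp [hiEdge, hm]
    refine hu.2.trans_lt ?_
    rw [e]
    exact hy.2.2 (Fin.lt_def.2 (by simp; omega))
  · have hab : a < b := Fin.succAbove_lt_succAbove_iff.1 hij
    rw [fib_succAbove]
    split_ifs with hb
    · calc u * (y b / hiEdge m y) = y b * (u / hiEdge m y) := by ring
        _ ≤ y b * 1 := mul_le_mul_of_nonneg_left ((div_le_one hh).2 hu.2) (hy.1 b).le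
        _ < y a := by rw [mul_one]; exact hy.2.2 hab
    · exact hy.2.2 hab

/-! ### The primitive and the kernel on a fibre -/

section PrimKern

variable (q : ℚ) (β γ : Fin (k + 1) → ℤ) (α : Fin (k + 1) → Fin (k + 1) → ℤ)

/-- The primitive of the Newton–Leibniz move on the fibre over `y`:
`prim y u = u^{k+1-m} / H^{k-m} · smono (fib m y u)`. -/
def prim (y : Fin k → ℝ) (u : ℝ) : ℝ :=
  u ^ (k + 1 - (m : ℕ)) / hiEdge m y ^ (k - (m : ℕ)) * smono q β γ α (fib m y u)

/-- The kernel on the fibre over `y`: `(u/H)^{k-m} · smono (fib y u) · ((k+1-m) + brkt (fib y u))`. -/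
def kern (y : Fin k → ℝ) (u : ℝ) : ℝ :=
  (u / hiEdge m y) ^ (k - (m : ℕ)) *
    (smono q β γ α (fib m y u) * (((k : ℝ) + 1 - (m : ℝ)) + brkt m β γ α (fib m y u)))

/-- The cone monomial on the fibre. -/
def fibQ (y : Fin k → ℝ) (u : ℝ) : ℝ := smonoQ m q β γ α (fibS m y) (fib m y u)

/-- The primitive vanishes at `u = 0`. -/
theorem prim_zero (y : Fin k → ℝ) : prim m q β γ α y 0 = 0 := by
  unfold prim
  rw [zero_pow (by omega), zero_div, zero_mul]

/-- The primitive at the upper edge is `H · smono (insertNth m H y)`. -/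
theorem prim_hiEdge {y : Fin k → ℝ} (hy : y ∈ KZ.openOrderedSimplex k) :
    prim m q β γ α y (hiEdge m y) = hiEdge m y * smono q β γ α (Fin.insertNth m (hiEdge m y) y) := by
  have hh := (hiEdge_pos m hy).ne'
  unfold prim
  have e : hiEdge m y ^ (k + 1 - (m : ℕ)) / hiEdge m y ^ (k - (m : ℕ)) = hiEdge m y := by
    rw [div_eq_iff (pow_ne_zero _ hh), show k + 1 - (m : ℕ) = (k - (m : ℕ)) + 1 by omega, pow_succ']
  rw [fib_hiEdge m hh, e]

/-- **The fibrewise derivative**: `∂ᵤ prim = kern` on the open fibre `0 < u < H`. [folklore] -/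
theorem hasDerivAt_prim {y : Fin k → ℝ} (hy : y ∈ KZ.openOrderedSimplex k) {u : ℝ} (hu : 0 < u)
    (huh : u < hiEdge m y) : HasDerivAt (prim m q β γ α y) (kern m q β γ α y u) u := by
  have hh := hiEdge_pos m hy
  have hmem : fib m y u ∈ KZ.openOrderedSimplex (k + 1) := dinv_insertNth_mem m hy hu huh
  obtain ⟨h0, h1, hanti⟩ := hmem
  have e : ∀ i, fibA m y i + u * fibB m y i = fib m y u i := fun i => by
    have := congrFun (fib_eq_affine m y u) i
    simpa [smul_eq_mul] using this.symm
  have hD := hasDerivAt_smono_affine q β γ α (fibA m y) (fibB m y) u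
    (fun i => by rw [e]; exact (h0 i).ne') (fun i => by rw [e]; exact (sub_pos.2 (h1 i)).ne')
    (fun i j hij => by rw [e, e]; exact (sub_pos.2 (hanti hij)).ne')
  have hfun : (fun s => smono q β γ α (fibA m y + s • fibB m y)) = fun s => smono q β γ α (fib m y s) :=
    funext fun s => by rw [fib_eq_affine]
  rw [hfun, ← fib_eq_affine] at hD
  have hEu : u * logDer β γ α (fib m y u) (fibB m y) = brkt m β γ α (fib m y u) :=
    mul_logDer_eq_brkt m β γ α _ _ u (mul_fibB m y u) (fun i => (h0 i).ne')
      (fun i j hij => (sub_pos.2 (hanti hij)).ne')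
  have hP : HasDerivAt (fun s : ℝ => s ^ (k + 1 - (m : ℕ)))
      (((k + 1 - (m : ℕ) : ℕ) : ℝ) * u ^ (k + 1 - (m : ℕ) - 1)) u := hasDerivAt_pow _ u
  have hPD := (hP.mul hD).div_const (hiEdge m y ^ (k - (m : ℕ)))
  have hprim : prim m q β γ α y = fun s => s ^ (k + 1 - (m : ℕ)) * smono q β γ α (fib m y s) /
      hiEdge m y ^ (k - (m : ℕ)) := funext fun s => by unfold prim; ring
  rw [hprim]
  refine hPD.congr_deriv ?_
  unfold kern
  rw [← hEu, show k + 1 - (m : ℕ) - 1 = k - (m : ℕ) by omega,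
    show u ^ (k + 1 - (m : ℕ)) = u ^ (k - (m : ℕ)) * u by rw [← pow_succ]; congr 1; omega,
    show ((k + 1 - (m : ℕ) : ℕ) : ℝ) = (k : ℝ) + 1 - (m : ℝ) by
      rw [Nat.cast_sub (by omega)]; push_cast; ring,
    div_pow]
  field_simp

/-- **Factorisation of the primitive on the closed fibre**: `prim y u = u^E · fibQ y u / H^{k-m}`
with `E = (k+1-m) + dilExp > 0` (both sides vanish at `u = 0`). [folklore] -/
theorem prim_eq_zpow_mul {y : Fin k → ℝ} (hE : 0 < ((k : ℤ) + 1 - (m : ℤ)) + dilExp m β α)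
    {u : ℝ} (hu : 0 ≤ u) :
    prim m q β γ α y u =
      u ^ (((k : ℤ) + 1 - (m : ℤ)) + dilExp m β α) * fibQ m q β γ α y u / hiEdge m y ^ (k - (m : ℕ)) := by
  unfold prim fibQ
  rcases eq_or_lt_of_le hu with h0 | hu0
  · rw [← h0, zero_pow (by omega), zero_zpow _ hE.ne', zero_div, zero_mul, zero_mul, zero_div]
  · rw [smono_eq_zpow_mul_smonoQ m q β γ α (fibS m y) (fib m y u) hu0.ne' (fib_apply m y u),
      ← zpow_natCast, zpow_add₀ hu0.ne',
      show (((k + 1 - (m : ℕ) : ℕ)) : ℤ) = (k : ℤ) + 1 - (m : ℤ) by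
        rw [Nat.cast_sub (by omega)]; push_cast; ring]
    ring

/-- The cone monomial is continuous on the closed fibre (the collapsing letter at `u = H` has a
non-negative exponent). [folklore] -/
theorem continuousOn_fibQ {y : Fin k → ℝ} (hy : y ∈ KZ.openOrderedSimplex k)
    (hface : if h : 0 < (m : ℕ) then 0 ≤ α ⟨(m : ℕ) - 1, by omega⟩ m else 0 ≤ γ m) :
    ContinuousOn (fibQ m q β γ α y) (Icc 0 (hiEdge m y)) := by
  unfold fibQ smonoQ
  refine continuousOn_const.mul ((continuousOn_const.mul ?_).mul ?_)
  · refine continuousOn_finsetProd _ fun i _ => ?_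
    refine ((continuous_const.sub (continuous_fib_apply m y i)).continuousOn).zpow₀ _ fun u hu => ?_
    by_cases hi : i ≠ m ∨ 0 < (m : ℕ)
    · exact Or.inl (sub_pos.2 (fib_lt_one m hy hu i hi)).ne'
    · right
      have him : i = m := by
        by_contra h
        exact hi (Or.inl h)
      have hm : ¬ 0 < (m : ℕ) := fun h => hi (Or.inr h)
      subst him
      rw [dif_neg hm] at hface
      exact hface
  · refine continuousOn_finsetProd _ fun i _ => continuousOn_finsetProd _ fun j _ => ?_
    by_cases hij : i < j
    · simp only [if_pos hij]
      by_cases hmi : m ≤ i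
      · simp only [if_pos hmi]
        exact continuousOn_const
      · simp only [if_neg hmi]
        refine (((continuous_fib_apply m y i).sub (continuous_fib_apply m y j)).continuousOn).zpow₀
          _ fun u hu => ?_
        by_cases hex : j = m → (i : ℕ) + 1 < (m : ℕ)
        · exact Or.inl (fib_sub_fib_pos m hy hu hij (not_le.1 hmi) hex).ne'
        · right
          have hjm : j = m := by
            by_contra h
            exact hex fun h' => absurd h' h
          have hle : ¬ (i : ℕ) + 1 < (m : ℕ) := fun h => hex fun _ => h
          subst hjm
          have him : (i : ℕ) < (j : ℕ) := Fin.lt_def.1 (not_le.1 hmi)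
          have hm : 0 < (j : ℕ) := lt_of_le_of_lt (Nat.zero_le _) him
          have hi : i = ⟨(j : ℕ) - 1, lt_of_le_of_lt (Nat.sub_le _ _) j.2⟩ := Fin.ext (by simp; omega)
          rw [hi]
          rw [dif_pos hm] at hface
          exact hface
    · simp only [if_neg hij]
      exact continuousOn_const

/-- **The primitive is continuous on the closed fibre** `[0, H]`. [folklore] -/
theorem continuousOn_prim {y : Fin k → ℝ} (hy : y ∈ KZ.openOrderedSimplex k)
    (hface : if h : 0 < (m : ℕ) then 0 ≤ α ⟨(m : ℕ) - 1, by omega⟩ m else 0 ≤ γ m)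
    (hE : 0 < ((k : ℤ) + 1 - (m : ℤ)) + dilExp m β α) :
    ContinuousOn (prim m q β γ α y) (Icc 0 (hiEdge m y)) := by
  have hc : ContinuousOn (fun u : ℝ => u ^ (((k : ℤ) + 1 - (m : ℤ)) + dilExp m β α) *
      fibQ m q β γ α y u / hiEdge m y ^ (k - (m : ℕ))) (Icc 0 (hiEdge m y)) :=
    ((continuousOn_zpow_Icc _ (Or.inr hE.le)).mul (continuousOn_fibQ m q β γ α hy hface)).div_const _
  exact hc.congr fun u hu => prim_eq_zpow_mul m q β γ α hE hu.1

end PrimKern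

end Dilation

/-- **Registered sub-goal `stub_dilationNLAux4`** of `stub_dilationNL` (the dilated slots of the
fibre: `m ≤ m.succAbove j ↔ m ≤ castSucc j`, `Dilation.le_succAbove_iff`). [folklore] -/
theorem stub_dilationNLAux4 : ∀ (k : ℕ) (m : Fin (k + 1)) (j : Fin k), m ≤ m.succAbove j ↔ m ≤ Fin.castSucc j :=
  fun _ m j => Dilation.le_succAbove_iff m j

end Summit.KontsevichZagierPeriods.DihedralNormalForm.TorusDescent
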